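import Literature.NumberTheory.LFunctions.RayClassExplicitFormula
import Literature.NumberTheory.LFunctions.ClassGroupExplicitFormulaBounds
import HarnessLib

/-!
# Bounds for the secondary terms of the ray-class explicit formula against the Thorner–Zaman weight

Topic `Literature/NumberTheory/LFunctions`; namespace `Literature.NumberTheory.LFunctions`.  Pure-proof companion
of `RayClassExplicitFormula.lean`; the ray-class analogue (conductor `𝔣 = 𝔪`) of
`ClassGroupExplicitFormulaBounds.lean`.  Everything here is PROVED; no definition and no named fact is introduced.

For a primitive ray class character `χ mod 𝔪 ≠ 0` of sign type `p`, non-principal on the ideals prime to `𝔪`,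
entire continuations `L`, `L̄` of `L(χ, ·)`, `L(χ̄, ·)`, `A = |d_K| 𝔑𝔪`, and the weight `g = tzTest X ε`
(`X = log x`, `0 < ε < X/2`), the explicit formula `rcCoefFordK_eq_explicit` at `s = 0` carries, besides the
zero sum, the terms `m₀ F(0)` and the left-line integral `J(0)`:

* `norm_rcEFRemainder_tzTest_zero_le` —
  `‖J(0)‖ ≤ leftLineConst · C (n_K + 1) · (log A + log 4 + 1) · e^{−X/4 + ε/2} · (2M/ε)`
  (`|L'/L(−1/2 + iy)| ≤ C(n_K+1)(log A + log(|y| + 4))` of `exists_norm_logDeriv_continuation_left_le` against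
  `‖F(1/2 − iy)‖ ≤ e^{−X/4+ε/2} (2M/ε)/(1/4 + y²)`);
* `norm_continuation_le_of_re_ge` — the convexity bound `‖L(z)‖ ≤ A e^{2n_K} ‖z + 5/2‖^{n_K}` (`Re z ≥ −1/2`)
  for EVERY entire continuation `L` (uniqueness of the continuation);
* `analyticOrderNatAt_continuation_zero_le` — `m₀ ≤ 8 (log A + 6 n_K)` (Jensen in `|s − 3/2| ≤ 7/4 ⊂ |s − 3/2| ≤ 2`).

## References

* J. Thorner, A. Zaman, ANT 13 (2019), Lemma 4.3, §4.3; Lemma 2.5. [ThornerZaman2019]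
* J. C. Lagarias, A. M. Odlyzko, in *Algebraic Number Fields* (1977), Lemma 5.4, §7. [LagariasOdlyzko1977]
* H. Rademacher, Math. Z. 72 (1959), Theorem 4. [Rademacher1959]
-/

noncomputable section

open Complex Real MeasureTheory Set Filter Topology Metric NumberField NumberField.InfinitePlace IsDedekindDomain
open scoped NumberField nonZeroDivisors

namespace Literature.NumberTheory.LFunctions

open Literature.NumberTheory.LFunctions.TZWeight Literature.NumberTheory.LFunctions.EntireEF

variable {K : Type} [Field K] [NumberField K]
variable {𝔪 : Ideal (𝓞 K)} {ψ : HeightOneSpectrum (𝓞 K) → ℂ} {p : Finset {w : InfinitePlace K // IsReal w}}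

/-! ### The left-line integral `J(0)` -/

/-- **`‖J(0)‖ ≤ leftLineConst · C(n_K+1) · (log(|d_K|𝔑𝔪) + log 4 + 1) · e^{−X/4+ε/2} (2M/ε)`** for the TZ weight
`tzTest X ε`, with the constant `C` of `exists_norm_logDeriv_continuation_left_le`. [cite: ThornerZaman2019, Lemma 4.3] -/
theorem norm_rcEFRemainder_tzTest_zero_le {C : ℝ} (hC0 : 0 < C)
    (hC : ∀ (K : Type) [Field K] [NumberField K] (𝔪 : Ideal (𝓞 K))
      (ψ : HeightOneSpectrum (𝓞 K) → ℂ) (p : Finset {w : InfinitePlace K // IsReal w}),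
      IsRayClassCharacter 𝔪 ψ → IsPrimitive 𝔪 ψ → IsSignType 𝔪 ψ p → 𝔪 ≠ ⊥ →
      ∀ (L L' : ℂ → ℂ), Differentiable ℂ L → (∀ s : ℂ, 1 < s.re → L s = rayClassLSeries 𝔪 ψ s) →
        Differentiable ℂ L' → (∀ s : ℂ, 1 < s.re → L' s = rayClassLSeries 𝔪 (star ψ) s) →
      ∀ t : ℝ, ‖logDeriv L (-1 / 2 + t * I)‖ ≤
        C * (Module.finrank ℚ K + 1) * (Real.log (|(discr K : ℝ)| * (Ideal.absNorm 𝔪 : ℝ)) + Real.log (|t| + 4)))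
    (hψ : IsRayClassCharacter 𝔪 ψ) (hprim : IsPrimitive 𝔪 ψ) (hp : IsSignType 𝔪 ψ p) (h𝔪 : 𝔪 ≠ ⊥)
    (hnt : ∃ v : HeightOneSpectrum (𝓞 K), ¬ 𝔪 ≤ v.asIdeal ∧ ψ v ≠ 1)
    {L L' : ℂ → ℂ} (hL : Differentiable ℂ L) (hLs : ∀ s : ℂ, 1 < s.re → L s = rayClassLSeries 𝔪 ψ s)
    (hL' : Differentiable ℂ L') (hL's : ∀ s : ℂ, 1 < s.re → L' s = rayClassLSeries 𝔪 (star ψ) s)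
    {M : ℝ} (hM : ∀ y : ℝ, |iteratedDeriv 1 Real.smoothTransition y| ≤ M ∧ |iteratedDeriv 2 Real.smoothTransition y| ≤ M)
    {X ε : ℝ} (hX : 0 < X) (hε : 0 < ε) (hεX : ε < X / 2) :
    ‖rcEFRemainder L (tzTest X ε) 0‖ ≤
      NumberField.leftLineConst * (C * (Module.finrank ℚ K + 1)) *
        (Real.log (|(discr K : ℝ)| * (Ideal.absNorm 𝔪 : ℝ)) + Real.log 4 + 1) *
        (Real.exp (-(X / 4) + ε / 2) * (2 * M / ε)) := by
  have hM0 : 0 ≤ M := le_trans (abs_nonneg _) (hM 0).1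
  have hlogA : 0 ≤ Real.log (|(discr K : ℝ)| * (Ideal.absNorm 𝔪 : ℝ)) := by
    refine Real.log_nonneg ?_
    have h1 : (1 : ℝ) ≤ |(discr K : ℝ)| := by
      have := Int.one_le_abs (discr_ne_zero K)
      rw [← Int.cast_abs]; exact_mod_cast this
    have h2 : (1 : ℝ) ≤ (Ideal.absNorm 𝔪 : ℝ) := by
      exact_mod_cast Nat.one_le_iff_ne_zero.mpr (by rwa [ne_eq, Ideal.absNorm_eq_zero_iff])
    nlinarith
  rw [rcEFRemainder]
  simp_rw [rcEFIntegrand]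
  refine NumberField.norm_leftLine_integral_le (by positivity) ?_ (by positivity) (fun y ↦ ?_)
    (fun y ↦ NumberField.norm_fordLaplace_tzTest_leftLine_le hM hX hε hεX y) ?_
  · have : 0 ≤ Real.log 4 := Real.log_nonneg (by norm_num)
    linarith
  · rw [norm_neg]
    have e : (((-(1 / 2) : ℝ) : ℂ) + y * I : ℂ) = -1 / 2 + y * I := by push_cast; ring
    rw [e]
    refine (hC K 𝔪 ψ p hψ hprim hp h𝔪 L L' hL hLs hL' hL's y).trans ?_
    have hlog4 : Real.log (|y| + 4) ≤ Real.log 4 + Real.log (1 + |y|) := by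
      rw [← Real.log_mul (by norm_num) (by linarith [abs_nonneg y])]
      exact Real.log_le_log (by linarith [abs_nonneg y]) (by nlinarith [abs_nonneg y])
    have hl1 : 0 ≤ Real.log (1 + |y|) := Real.log_nonneg (by linarith [abs_nonneg y])
    refine mul_le_mul_of_nonneg_left ?_ (by positivity)
    linarith
  · have hint := integrable_rcIntegrand_left hψ hprim hp h𝔪 hnt hL hLs hL' hL's (isSmoothedEFTest_tzTest hX hε)
      (tzTest_zero hX hε hεX.le) (s := 0) (by simp)
    simp_rw [rcEFIntegrand] at hint
    exact hint.aestronglyMeasurable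

/-! ### The convexity bound for every continuation, and the order of vanishing at `0` -/

/-- **Rademacher's convexity bound holds for EVERY entire continuation** `L` of `L(χ, ·)`:
`‖L(z)‖ ≤ |d_K|𝔑𝔪 · e^{2n_K} · ‖z + 5/2‖^{n_K}` for `Re z ≥ −1/2` (uniqueness of the continuation).
[cite: Rademacher1959, Theorem 4] -/
theorem norm_continuation_le_of_re_ge (hψ : IsRayClassCharacter 𝔪 ψ) (hprim : IsPrimitive 𝔪 ψ)
    (hp : IsSignType 𝔪 ψ p) (h𝔪 : 𝔪 ≠ ⊥)
    (hnt : ∃ v : HeightOneSpectrum (𝓞 K), ¬ 𝔪 ≤ v.asIdeal ∧ ψ v ≠ 1)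
    {L : ℂ → ℂ} (hL : Differentiable ℂ L) (hLs : ∀ s : ℂ, 1 < s.re → L s = rayClassLSeries 𝔪 ψ s)
    {z : ℂ} (hz : -1 / 2 ≤ z.re) :
    ‖L z‖ ≤ (|(discr K : ℝ)| * (Ideal.absNorm 𝔪 : ℝ)) * Real.exp (2 * Module.finrank ℚ K) *
      ‖z + 5 / 2‖ ^ Module.finrank ℚ K := by
  obtain ⟨L₀, hL₀d, hL₀s, hb⟩ := exists_continuation_norm_le hψ hprim hp h𝔪 hnt
  have hLL : L = L₀ := by
    have h := AnalyticOnNhd.eqOn_of_preconnected_of_eventuallyEq (𝕜 := ℂ)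
      (hL.differentiableOn.analyticOnNhd isOpen_univ) (hL₀d.differentiableOn.analyticOnNhd isOpen_univ)
      isPreconnected_univ (Set.mem_univ (2 : ℂ)) ?_
    · exact funext fun s ↦ h (Set.mem_univ s)
    · refine eventually_of_mem ((continuous_re.isOpen_preimage _ isOpen_Ioi).mem_nhds (by simp : 1 < (2 : ℂ).re))
        fun t (ht : 1 < t.re) ↦ ?_
      rw [hLs t ht, hL₀s t ht]
  rw [hLL]
  exact hb z hz

/-- **`ord₀ L ≤ 8 (log(|d_K|𝔑𝔪) + 6 n_K)`** for every entire continuation `L` of `L(χ, ·)` (Jensen in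
`|s − 3/2| ≤ 7/4`; on `|s − 3/2| = 2`, `‖L‖ ≤ |d_K|𝔑𝔪 · e^{2n} 6^n`; `‖L(3/2)‖ ≥ e^{−2n}`).
[cite: LagariasOdlyzko1977, Lemma 5.4] [cite: ThornerZaman2019, Lemma 2.5] -/
theorem analyticOrderNatAt_continuation_zero_le (hψ : IsRayClassCharacter 𝔪 ψ) (hprim : IsPrimitive 𝔪 ψ)
    (hp : IsSignType 𝔪 ψ p) (h𝔪 : 𝔪 ≠ ⊥)
    (hnt : ∃ v : HeightOneSpectrum (𝓞 K), ¬ 𝔪 ≤ v.asIdeal ∧ ψ v ≠ 1)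
    {L : ℂ → ℂ} (hL : Differentiable ℂ L) (hLs : ∀ s : ℂ, 1 < s.re → L s = rayClassLSeries 𝔪 ψ s) :
    (analyticOrderNatAt L 0 : ℝ) ≤
      8 * (Real.log (|(discr K : ℝ)| * (Ideal.absNorm 𝔪 : ℝ)) + 6 * Module.finrank ℚ K) := by
  set n : ℕ := Module.finrank ℚ K with hn
  set A : ℝ := |(discr K : ℝ)| * (Ideal.absNorm 𝔪 : ℝ) with hA
  have hA1 : 1 ≤ A := by
    have h1 : (1 : ℝ) ≤ |(discr K : ℝ)| := by
      have := Int.one_le_abs (discr_ne_zero K)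
      rw [← Int.cast_abs]; exact_mod_cast this
    have h2 : (1 : ℝ) ≤ (Ideal.absNorm 𝔪 : ℝ) := by
      exact_mod_cast Nat.one_le_iff_ne_zero.mpr (by rwa [ne_eq, Ideal.absNorm_eq_zero_iff])
    rw [hA]; nlinarith
  have hE : (1 : ℝ) ≤ Real.exp (2 * n) := Real.one_le_exp (by positivity)
  have h6 : (1 : ℝ) ≤ (6 : ℝ) ^ n := one_le_pow₀ (by norm_num)
  set B : ℝ := A * Real.exp (2 * n) * (6 : ℝ) ^ n with hB
  have hB1 : 1 ≤ B := by
    calc (1 : ℝ) = 1 * 1 * 1 := by ring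
      _ ≤ B := by rw [hB]; gcongr
  have hlogB : Real.log B ≤ Real.log A + 4 * n := by
    rw [hB, Real.log_mul (by positivity) (by positivity), Real.log_mul (by positivity) (by positivity), Real.log_exp,
      Real.log_pow]
    have hlog6 : Real.log 6 ≤ 2 := by
      rw [Real.log_le_iff_le_exp (by norm_num)]
      have := Real.exp_one_gt_d9
      have h : Real.exp 2 = Real.exp 1 * Real.exp 1 := by rw [← Real.exp_add]; norm_num
      rw [h]; nlinarith
    have : (n : ℝ) * Real.log 6 ≤ 2 * n := by nlinarith [(n.cast_nonneg : (0 : ℝ) ≤ n)]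
    linarith
  have hψ1 : ∀ v : HeightOneSpectrum (𝓞 K), ¬ 𝔪 ≤ v.asIdeal → ‖ψ v‖ ≤ 1 := fun v hv ↦ (hψ.norm_eq_one v hv).le
  have key := NumberField.analyticOrderNatAt_zero_le_of_bounds hL hB1 (by positivity : (0:ℝ) ≤ 2 * n)
    (fun z hz ↦ ?_) ?_
  · refine key.trans ?_
    linarith
  · obtain ⟨hre, h6z, -⟩ := NumberField.sphere_three_halves_facts hz
    have hb := norm_continuation_le_of_re_ge hψ hprim hp h𝔪 hnt hL hLs hre
    have hpow : ‖z + 5 / 2‖ ^ n ≤ (6 : ℝ) ^ n := pow_le_pow_left₀ (norm_nonneg _) h6z _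
    have hd0 : 0 ≤ A * Real.exp (2 * n) := by positivity
    rw [hB]
    exact hb.trans (mul_le_mul_of_nonneg_left hpow hd0)
  · have hs : 1 < (((3 / 2 : ℝ) : ℂ)).re := by simp; norm_num
    rw [hLs _ hs]
    have h := exp_neg_finrank_div_le_norm_rayClassLSeries h𝔪 hψ1 hs
    have hre : (((3 / 2 : ℝ) : ℂ)).re - 1 = 1 / 2 := by simp; norm_num
    rw [hre] at h
    refine le_trans (le_of_eq ?_) h
    congr 1; rw [hn]; ring

end Literature.NumberTheory.LFunctions
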